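import Literature.NumberTheory.LFunctions.Zhang2022.ObjectiveTwinEllFrameLimitC

/-!
# Zhang (2022) design-space objective, twin part 13: the `K₀` PLANE `span_ℂ{k₁+k₂, k₂+k₃}` — the pencil as an
# exact `2×2` Hermitian matrix, the singular leading form `8π|a − b|²`, and the degenerate direction `k₁+2k₂+k₃`

Y. Zhang, *Discrete mean estimates and the Landau–Siegel zero*, arXiv:2211.02515v1 (2022)
[Zhang2022LandauSiegel] — an unrefereed manuscript under adjudication. **This file SEARCHES and TYPES; it
makes no claim about Landau–Siegel zeros, about Theorems 1–2 of the manuscript, or about a repaired (2.32),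
until a kernel theorem says so.** LANDAU–SIEGEL programme, cell `landau-siegel`, §A Lean twin; B-ell block «K₀»
in the form of record since REF-B2 2026-08-26T21:18:07Z / ls-Bell-plan 21:21:27Z: the `K₀` sub-family is the
complex PLANE `K₀ ∩ {u(1) = 0} = span_ℂ{e₁ = k₁+k₂, e₂ = k₂+k₃}` (coefficients `x = (a, a+b, b)`), not three named
vectors. From the pencil `ellFormQ` (part 6):

* `ellFormQ_plane` — on the plane, `H(ℓ)` is the Hermitian `2×2` matrix
  `8π(1−ℓ)·[[d₁+d₂, d₂],[d₂, d₂+d₃]] + (1−ℓ)³·[[0, −128i],[128i, 0]]` (`d₁ = (1−2ℓ)(1−3ℓ)`, `d₂ = (2−ℓ)(2−3ℓ)`,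
  `d₃ = (3−ℓ)(3−2ℓ)`), i.e. `F = 8π(1−ℓ)[(d₁+d₂)|a|² + (d₂+d₃)|b|² + 2d₂Re(ab̄)] − 256(1−ℓ)³Im(ab̄)`: the real part is
  first order in `1−ℓ`, the imaginary cross is THIRD order (the lineage-A core's `Im F₁₂ ≈ 10⁻⁹` at `A = 2500`,
  kit j260462, is `128ε³/r`, not noise; the limit forms of record are real symmetric, ls-Bell-num-2 j260527);
* `ellFormN_one_plane` — the leading form `N(1) = 8π|a − b|²`: PSD on the plane and SINGULAR along `a = b`, the
  direction `u* = e₁ + e₂ = k₁ + 2k₂ + k₃` (REF-B2 «no cushion along k₁+2k₂+k₃»);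
* `ellFormQ_uStar` — `F_{1−η}(k₁+2k₂+k₃) = π(48η² + 160η³)` EXACTLY (no order-`η` term);
* physical frame: `mainTermFormEll_rescale_expComb_plane` (`= r⁻¹·H(ℓr)` on the plane), `phiLimC_plane`,
  `phiLimC_uStar` (`= ((A+C+1)/A)·π(48ε² + 160ε³)`, `ε = (C+½)/(A+C+½)`: the limit main term along `u*` is `O(A⁻²)`,
  so there the first-order `2×2` test decides «naked»), and the twin row `twinRow_uStar_A2500_C0`
  (`φ(u*) ∈ (6.0358·10⁻⁶, 6.0359·10⁻⁶)` ∋ core j260462 `6.0359e-6`).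

Theorems only; no new definitions.
-/

noncomputable section

open Real Complex ComplexConjugate

namespace Literature.NumberTheory.LFunctions.Zhang2022

namespace EllRegime

open EllScales Objective

/-- `‖z‖² = Re² + Im²`. [folklore] -/
private theorem normSq_re_im'' (z : ℂ) : ‖z‖ ^ 2 = z.re ^ 2 + z.im ^ 2 := by
  rw [Complex.sq_norm, Complex.normSq_apply]; ring

/-- **The pencil on the `K₀` plane as a `2×2` Hermitian form** (`x = (a, a+b, b)` ↔ `a·(k₁+k₂) + b·(k₂+k₃)`):
`ellFormQ ℓ a (a+b) b = 8π(1−ℓ)[(d₁+d₂)|a|² + (d₂+d₃)|b|² + 2d₂·Re(ab̄)] − 256(1−ℓ)³·Im(ab̄)`.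
[cite: Zhang2022LandauSiegel, §2 (2.10), (2.13), (2.23)–(2.25)] -/
theorem ellFormQ_plane (ℓ : ℝ) (a b : ℂ) :
    ellFormQ ℓ a (a + b) b =
      8 * π * (1 - ℓ) * (((1 - 2 * ℓ) * (1 - 3 * ℓ) + (2 - ℓ) * (2 - 3 * ℓ)) * ‖a‖ ^ 2
        + ((2 - ℓ) * (2 - 3 * ℓ) + (3 - ℓ) * (3 - 2 * ℓ)) * ‖b‖ ^ 2
        + 2 * ((2 - ℓ) * (2 - 3 * ℓ)) * (a * conj b).re)
      - 256 * (1 - ℓ) ^ 3 * (a * conj b).im := by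
  unfold ellFormQ
  rw [normSq_re_im'' a, normSq_re_im'' b, normSq_re_im'' (a + b)]
  simp only [map_add, Complex.add_re, Complex.add_im, Complex.mul_re, Complex.mul_im, Complex.conj_re,
    Complex.conj_im]
  ring

/-- **The leading form on the plane is `8π|a − b|²`**: `N(1)(a, a+b, b) = 8π‖a − b‖²` — PSD, singular exactly along
`a = b` (`u* = k₁ + 2k₂ + k₃`). [cite: Zhang2022LandauSiegel, §2 (2.10), (2.13)] -/
theorem ellFormN_one_plane (a b : ℂ) : ellFormN 1 a (a + b) b = 8 * π * ‖a - b‖ ^ 2 := by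
  rw [ellFormN_one, ellSlopeQ_plane]; ring

/-- **The degenerate direction**: `F_{1−η}(k₁ + 2k₂ + k₃) = π(48η² + 160η³)` — no order-`η` term.
[cite: Zhang2022LandauSiegel, §2 (2.10), (2.13), (2.23)–(2.25)] -/
theorem ellFormQ_uStar (η : ℝ) : ellFormQ (1 - η) 1 2 1 = π * (48 * η ^ 2 + 160 * η ^ 3) := by
  have h := ellFormQ_plane (1 - η) 1 1
  norm_num at h
  rw [h]
  ring

/-- `F_{1−η}(k₁ + 2k₂ + k₃) > 0` for `η > 0` (but only at second order). [cite: Zhang2022LandauSiegel, §2 (2.10), (2.13)] -/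
theorem ellFormQ_uStar_pos {η : ℝ} (hη : 0 < η) : 0 < ellFormQ (1 - η) 1 2 1 := by
  rw [ellFormQ_uStar]; positivity

/-! ## Physical frame on the plane -/

/-- The plane vector `a·(k₁+k₂) + b·(k₂+k₃)` in `expComb (1,2,3)` coordinates is `u = (−a, a+b, −b)` (`Σ u_j = 0`).
[cite: Zhang2022LandauSiegel, §2 (2.23)–(2.25)] -/
theorem sum_planeCoeff (a b : ℂ) : ∑ j, (![-a, a + b, -b] : Fin 3 → ℂ) j = 0 := by
  simp [Fin.sum_univ_three]

/-- **Physical frame, plane**: `F_ℓ(rescale r (a(k₁+k₂) + b(k₂+k₃))) = r⁻¹·ellFormQ (ℓr) a (a+b) b` (`0 < r ≤ 1`).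
[cite: Zhang2022LandauSiegel, §2 (2.10), (2.13), (2.23)–(2.25), (2.30)] -/
theorem mainTermFormEll_rescale_expComb_plane (a b : ℂ) (ℓ : ℝ) {r : ℝ} (hr : 0 < r) (hr1 : r ≤ 1) :
    mainTermFormEll ℓ (rescale r (expComb k123 ![-a, a + b, -b])) (rescale' r (expComb' k123 ![-a, a + b, -b])) =
      r⁻¹ * ellFormQ (ℓ * r) a (a + b) b := by
  rw [mainTermFormEll_rescale_expComb_k123 (sum_planeCoeff a b) ℓ hr hr1]
  simp

/-- The sheet limit on the plane: `phiLimC A C (−a, a+b, −b) = ((A+C+1)/A)·ellFormQ (A/(A+C+½)) a (a+b) b`.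
[cite: Zhang2022LandauSiegel, §2 (2.8), (2.10), (2.13), (2.30)] -/
theorem phiLimC_plane (A C : ℝ) (a b : ℂ) :
    phiLimC A C ![-a, a + b, -b] = (A + C + 1) / A * ellFormQ (A / (A + C + 1 / 2)) a (a + b) b := by
  simp [phiLimC]

/-- **No cushion along `u*`**: `phiLimC A C (k₁+2k₂+k₃) = ((A+C+1)/A)·π(48ε² + 160ε³)`, `ε = (C+½)/(A+C+½)` — the
limit main term is `O(A⁻²)` along the degenerate direction (`A·phiLimC → 0`), so there the first-order `2×2` test
decides alone. [cite: Zhang2022LandauSiegel, §2 (2.8), (2.10), (2.13), (2.30)] -/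
theorem phiLimC_uStar {A C : ℝ} (hA : 0 < A) (hC : 0 ≤ C) :
    phiLimC A C ![-1, 2, -1] = (A + C + 1) / A *
      (π * (48 * ((C + 1 / 2) / (A + C + 1 / 2)) ^ 2 + 160 * ((C + 1 / 2) / (A + C + 1 / 2)) ^ 3)) := by
  have h : A + C + 1 / 2 ≠ 0 := by linarith
  have hp := phiLimC_plane A C 1 1
  norm_num at hp
  rw [hp, sheet_ratio_eq h, ellFormQ_uStar]

/-- TWIN ROW for the degenerate direction at `A = 2500`, printed sheet: `φ(k₁+2k₂+k₃) = (2501/2500)·π·(48ε²+160ε³)`,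
`ε = 1/5001`, `∈ (6.0358·10⁻⁶, 6.0359·10⁻⁶)` (core j260462: `6.0359e-6`; `A·φ = 12π·(…)/A`-scale).
[cite: Zhang2022LandauSiegel, §2 (2.10), (2.13), (2.23)–(2.25), (2.30)] -/
theorem twinRow_uStar_A2500_C0 :
    (0.0000060358 : ℝ) < phiLimC 2500 0 ![-1, 2, -1] ∧ phiLimC 2500 0 ![-1, 2, -1] < 0.0000060359 := by
  have e : phiLimC 2500 0 ![-1, 2, -1] = (150190052 / 78171884375625 : ℝ) * π := by
    rw [phiLimC_uStar (by norm_num) le_rfl]; ring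
  rw [e]
  have h1 := Real.pi_gt_d20
  have h2 := Real.pi_lt_d20
  constructor <;> nlinarith

/-- The plane vector `e₁ + i·e₂` (REF-B2 (r1)): `ellFormQ ℓ 1 (1+i) i = 8π(1−ℓ)(d₁ + 2d₂ + d₃) + 256(1−ℓ)³`
(`Re(1·conj i) = 0`, `Im(1·conj i) = −1`): the sum of the two diagonal entries plus the third-order cross.
[cite: Zhang2022LandauSiegel, §2 (2.10), (2.13)] -/
theorem ellFormQ_plane_e1_I_e2 (ℓ : ℝ) :
    ellFormQ ℓ 1 (1 + Complex.I) Complex.I =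
      8 * π * (1 - ℓ) * ((1 - 2 * ℓ) * (1 - 3 * ℓ) + 2 * ((2 - ℓ) * (2 - 3 * ℓ)) + (3 - ℓ) * (3 - 2 * ℓ))
        + 256 * (1 - ℓ) ^ 3 := by
  rw [ellFormQ_plane]
  have h1 : ((1:ℂ) * conj Complex.I).re = 0 := by simp
  have h2 : ((1:ℂ) * conj Complex.I).im = -1 := by simp
  rw [h1, h2, norm_one, Complex.norm_I]
  ring

/-! ## PSD below the physical point on the wall-vanishing plane (appended) -/

/-- **On the `K₀` plane the pencil is `≥ 0` for every `0 < ℓ ≤ 1`** — not only at leading order: for `Σ u_j = 0`,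
`F_ℓ(expComb (1,2,3) u) = ℓ·𝔅(rescale ℓ (expComb …)) ≥ 0` (frame law of part 7 at `r = 1` plus the PSD theorem of
record). Together with `mainTermFormEll_half_witness` / `_twoThirds_witness` (part 6: indefinite on the
wall-value-free span for `ℓ ∈ [½, ⅔]`) this is the exact content of «sign box ≠ PSD; below `ℓ = 1` negativity lives on
`u(1⁻) ≠ 0`». [cite: Zhang2022LandauSiegel, §2 (2.10), (2.13), (2.23)–(2.25)] -/
theorem ellFormQ_nonneg_of_wallVanishing {u : Fin 3 → ℂ} (hu : ∑ j, u j = 0) {ℓ : ℝ} (h0 : 0 < ℓ) (h1 : ℓ ≤ 1) :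
    0 ≤ ellFormQ ℓ (-u 0) (u 1) (-u 2) := by
  rw [← mainTermFormEll_expComb_k123 ℓ u,
    mainTermFormEll_eq_mul_mainTermForm_rescale (onePieceWV_expComb k123 hu) h0 h1]
  exact mul_nonneg h0.le (mainTermForm_nonneg_of_isH1 (isH1_rescale (onePieceWV_expComb k123 hu) h0))

/-- Plane coordinates: `0 ≤ ellFormQ ℓ a (a+b) b` for all `a b : ℂ` and `0 < ℓ ≤ 1`. [cite: Zhang2022LandauSiegel, §2 (2.10), (2.13), (2.23)–(2.25)] -/
theorem ellFormQ_plane_nonneg (a b : ℂ) {ℓ : ℝ} (h0 : 0 < ℓ) (h1 : ℓ ≤ 1) : 0 ≤ ellFormQ ℓ a (a + b) b := by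
  have h := ellFormQ_nonneg_of_wallVanishing (sum_planeCoeff a b) h0 h1
  simpa using h

end EllRegime

end Literature.NumberTheory.LFunctions.Zhang2022
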